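import Literature.MathematicalPhysics.QuantumFieldTheory.ConformalBootstrap3D.PointKernelK57
import Literature.MathematicalPhysics.QuantumFieldTheory.ConformalBootstrap3D.PointKernelSigma
import Mathlib.Tactic
import HarnessLib

/-!
# The K57 column over the single-correlator class, and the two kernel-checked columns together

`PointKernelK57.boxExcluded_K57_strip` (p185567) excludes the strip
`[0.5165, 0.5175] × [1.5, ∞)` over `SatisfiesBootstrapAxioms`; the kernel's hypotheses are the same
finite checks that `PCert.sigmaBoxExcluded_of_kernelC_unbounded` (PointKernelSigma) turns into
exclusion over the LARGER, provably non-empty class `SatisfiesSigmaAxioms` (the projection of A1–A4 to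
the `σσσσ` correlator).  This file records

* `PointKernelK57.sigmaBoxExcluded_K57_strip : SigmaBoxExcluded (QBoxU (1033/2000) (207/400) (3/2))`
  and its unfolded / enclosure forms (`no_sigma_datum_in_K57_strip`, `epsDim_lt_of_K57_column_sigma`,
  `sigmaIsingEnclosure_K57_column`, `K57_class_nonempty`);
* the UNION of the two kernel-checked columns K57 `[0.5165, 0.5175] × [1.5, ∞)` and K34
  `[0.5175, 0.5185] × [1.6, ∞)` (`PointKernelK34.sigmaBoxExcluded_K34_unbounded`): on the window
  `0.5165 ≤ Δσ ≤ 0.5185` every datum has `Δ_ε < 1.6`, and `Δ_ε < 1.5` on its left half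
  (`PointKernelColumns.sigmaBoxExcluded_two_columns`, `no_sigma_datum_in_two_columns`,
  `no_cft_in_two_columns`, `epsDim_lt_of_two_columns`, `sigmaIsingEnclosure_two_columns`,
  `isingEnclosure_two_columns`).

Everything here is one-line logic over landed theorems. [cite: HogervorstRychkov2013, §3 eq. (3.6)]
-/

noncomputable section

namespace Literature.MathematicalPhysics.QuantumFieldTheory.ConformalBootstrap3D

open Real Set

namespace PointKernelK57

open PointKernel

/-- **The K57 strip is σ-excluded**: no datum satisfying the single-correlator axioms
(`SatisfiesSigmaAxioms`) has `(Δσ, Δ_ε) ∈ [0.5165, 0.5175] × [1.5, ∞)` — the kernel-checked K57-apex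
certificate read through the σ-schema. [cite: HogervorstRychkov2013, §3 eq. (3.6)] -/
theorem sigmaBoxExcluded_K57_strip : SigmaBoxExcluded (QBoxU (1033 / 2000) (207 / 400) (3 / 2)) :=
  PCert.sigmaBoxExcluded_of_kernelC_unbounded cert_checkNodes cert_sideOK 13 cert_o1OKC qdK57 qrK57 60
    cert_tOK (3 / 2) 24 1 23 59 cert_paramOK (by norm_num) hsegsK57 cert_hMetaOK mrowsK57 cert_mMetaOK
    hcells hboxes

/-- Unfolded: no datum satisfying the single-correlator axioms has `0.5165 ≤ Δσ ≤ 0.5175` and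
`1.5 ≤ Δ_ε`. [folklore] -/
theorem no_sigma_datum_in_K57_strip (D : SigmaEpsilonData) (hD : D.SatisfiesSigmaAxioms)
    (h1 : (0.5165 : ℝ) ≤ D.Δσ) (h2 : D.Δσ ≤ 0.5175) (h3 : (1.5 : ℝ) ≤ D.Δε) : False := by
  refine sigmaBoxExcluded_K57_strip D hD ?_
  simp only [QBoxU, Set.mem_setOf_eq]
  refine ⟨⟨?_, ?_⟩, ?_⟩ <;> push_cast <;> linarith

/-- Equivalently: inside the column `0.5165 ≤ Δσ ≤ 0.5175` every datum satisfying the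
single-correlator axioms has `Δ_ε < 1.5`. [folklore] -/
theorem epsDim_lt_of_K57_column_sigma (D : SigmaEpsilonData) (hD : D.SatisfiesSigmaAxioms)
    (h1 : (0.5165 : ℝ) ≤ D.Δσ) (h2 : D.Δσ ≤ 0.5175) : D.Δε < 1.5 := by
  by_contra h
  exact no_sigma_datum_in_K57_strip D hD h1 h2 (not_lt.1 h)

/-- The hypothesis class is non-empty (the free scalar), and its member lies outside the excluded strip.
[folklore] -/
theorem K57_class_nonempty :
    ∃ D : SigmaEpsilonData, D.SatisfiesSigmaAxioms ∧
      (D.Δσ, D.Δε) ∉ QBoxU (1033 / 2000) (207 / 400) (3 / 2) :=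
  ⟨freeScalarData, freeScalarData_satisfiesSigmaAxioms,
    sigmaBoxExcluded_K57_strip freeScalarData freeScalarData_satisfiesSigmaAxioms⟩

/-- σ-enclosure form of the K57 column: inside the window `0.5165 ≤ Δσ ≤ 0.5175` (any `Δ_ε`) every
datum satisfying the single-correlator axioms lies in `Δ_ε < 1.5`. [folklore] -/
theorem sigmaIsingEnclosure_K57_column :
    SigmaIsingEnclosure {p : ℝ × ℝ | (0.5165 : ℝ) ≤ p.1 ∧ p.1 ≤ 0.5175} {p : ℝ × ℝ | p.2 < 1.5} :=
  fun D hD hW => epsDim_lt_of_K57_column_sigma D hD hW.1 hW.2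

end PointKernelK57

/-! ### The two kernel-checked columns together -/

namespace PointKernelColumns

open PointKernel

/-- **Both kernel-checked strips are σ-excluded**: the union
`[0.5165, 0.5175] × [1.5, ∞) ∪ [0.5175, 0.5185] × [1.6, ∞)`. [folklore] -/
theorem sigmaBoxExcluded_two_columns :
    SigmaBoxExcluded (QBoxU (1033 / 2000) (207 / 400) (3 / 2) ∪ QBoxU (207 / 400) (1037 / 2000) (8 / 5)) :=
  PointKernelK57.sigmaBoxExcluded_K57_strip.union PointKernelK34.sigmaBoxExcluded_K34_unbounded

/-- Unfolded on the common height: no datum satisfying the single-correlator axioms has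
`0.5165 ≤ Δσ ≤ 0.5185` and `1.6 ≤ Δ_ε`. [folklore] -/
theorem no_sigma_datum_in_two_columns (D : SigmaEpsilonData) (hD : D.SatisfiesSigmaAxioms)
    (h1 : (0.5165 : ℝ) ≤ D.Δσ) (h2 : D.Δσ ≤ 0.5185) (h3 : (1.6 : ℝ) ≤ D.Δε) : False := by
  by_cases h : D.Δσ ≤ 0.5175
  · exact PointKernelK57.no_sigma_datum_in_K57_strip D hD h1 h (by linarith)
  · exact PointKernelK34.no_sigma_datum_in_K34_strip D hD (by linarith [not_le.1 h]) h2 h3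

/-- The same over the bootstrap axioms A0–A5 (`SatisfiesBootstrapAxioms ⊆ SatisfiesSigmaAxioms`).
[folklore] -/
theorem no_cft_in_two_columns (D : SigmaEpsilonData) (hD : D.SatisfiesBootstrapAxioms)
    (h1 : (0.5165 : ℝ) ≤ D.Δσ) (h2 : D.Δσ ≤ 0.5185) (h3 : (1.6 : ℝ) ≤ D.Δε) : False :=
  no_sigma_datum_in_two_columns D hD.sigmaAxioms h1 h2 h3

/-- Inside the window `0.5165 ≤ Δσ ≤ 0.5185` every datum satisfying the single-correlator axioms has
`Δ_ε < 1.6`, and `Δ_ε < 1.5` if moreover `Δσ ≤ 0.5175`. [folklore] -/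
theorem epsDim_lt_of_two_columns (D : SigmaEpsilonData) (hD : D.SatisfiesSigmaAxioms)
    (h1 : (0.5165 : ℝ) ≤ D.Δσ) (h2 : D.Δσ ≤ 0.5185) :
    D.Δε < 1.6 ∧ (D.Δσ ≤ 0.5175 → D.Δε < 1.5) := by
  refine ⟨?_, fun h => PointKernelK57.epsDim_lt_of_K57_column_sigma D hD h1 h⟩
  by_contra h
  exact no_sigma_datum_in_two_columns D hD h1 h2 (not_lt.1 h)

/-- σ-enclosure form: window `0.5165 ≤ Δσ ≤ 0.5185`, region
`{Δ_ε < 1.6} ∩ {Δσ ≤ 0.5175 → Δ_ε < 1.5}`. [folklore] -/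
theorem sigmaIsingEnclosure_two_columns :
    SigmaIsingEnclosure {p : ℝ × ℝ | (0.5165 : ℝ) ≤ p.1 ∧ p.1 ≤ 0.5185}
      {p : ℝ × ℝ | p.2 < 1.6 ∧ (p.1 ≤ 0.5175 → p.2 < 1.5)} :=
  fun D hD hW => epsDim_lt_of_two_columns D hD hW.1 hW.2

/-- The same enclosure over the bootstrap axioms A0–A5. [folklore] -/
theorem isingEnclosure_two_columns :
    IsingEnclosure {p : ℝ × ℝ | (0.5165 : ℝ) ≤ p.1 ∧ p.1 ≤ 0.5185}
      {p : ℝ × ℝ | p.2 < 1.6 ∧ (p.1 ≤ 0.5175 → p.2 < 1.5)} :=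
  sigmaIsingEnclosure_two_columns.isingEnclosure

end PointKernelColumns

end Literature.MathematicalPhysics.QuantumFieldTheory.ConformalBootstrap3D
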